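import Summits.CriticalPhenomena.PercolationContinuityZ3.Theorems.Transplant.SkeletonFrmQuasiCustomersHolds
import Summits.CriticalPhenomena.PercolationContinuityZ3.Theorems.Transplant.Z3NetFilms
import HarnessLib

/-!
# The `(001)`-FILMS of every PERIODIC NET on `ℤ³` die at their own critical points (modulo film-connectedness): `p_c < 1` and `θ_v(p_c) = 0` at
# every vertex of every connected film `{a ≤ x₂ ≤ b}` of every `N : Z3Net` with positive periods — the doubly-periodic customer of the rung-Q node

builds on p205010 (kernel theorem, internal audit signed; external expert review pending).  Lane `prim-bschramm`, seat `prim-bschramm-stmt`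
gen 36 (statements seat; by-name customer of the rung-Q node); helper file (`--supports stmt-CriticalPhenomena-4575 --as helper`); PROOFS ONLY (def-free).

THE POINT.  For a net `N : Z3Net` («Z3NetDefs», p2 gen 12) periodic with positive periods `nᵢ eᵢ`, the film `F_{a,b} = {a ≤ x₂ ≤ b}` («Z3NetFilms» `Z3Net.film a b`,
induced subgraph) carries the FREE action of the HORIZONTAL period lattice `n₀ℤ × n₁ℤ ≅ ℤ²` by the scaled translations `x ↦ x + (n₀a₀, n₁a₁, 0)` — by
automorphisms (`Z3Net.adj_add_right`), preserving the film, with the finitely many orbits of the box `[0,n₀) × [0,n₁) × [a,b]` (§1).  So the rung-Q node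
(«SkelFrmQuasiProxHoldsAll», p553137) through «SkeletonFrmQuasiCustomersHolds» §`AutChart.conj4_zTwoPeriodic_holds` gives, for every CONNECTED film and every
vertex: **`p_c(v) < 1` and `θ_v(p_c(v)) = 0`** — `Z3Net.film_conj4_of_periodic`, `Z3Net.film_criticalContinuity_of_periodic`.  Film-connectedness stays a
HYPOTHESIS: films of periodic nets can be disconnected (the two-layer diamond film, «DiamondFilmOwnCriticalContinuityOneFalse» p563640).  This is the umbrella
over the film rows the lane closed class by class — TARGET 2ac `Z3Net.FlatSym.film_criticalContinuity` («Z3NetFilms» p306686: flat, linked, sign-symmetric nets,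
connectedness from `filmCol_connected`) and TARGET 2u `UnitGens.slab_conj4_holds` («Z3UnitGensSlabAll» p571396: constant nets) — which keep their rows (they
discharge connectedness); every other periodic film (anisotropic, non-symmetric, long in-plane range) is covered as soon as its connectedness is typed.  Not a
`@[conjecture]` node of the tree.  IN PRINT: only `ℤ² × {0..k}` (Duminil-Copin–Sidoravicius–Tassion 2016).  Nothing is claimed at the ambient net's critical point,
nor about Conj. 4 beyond these periodic instances.
* §1 the horizontal residue `hres n v = (v₀ mod n₀, v₁ mod n₁, v₂)` and the finite set of film base vertices (`hres_mem_film`, `sub_hres_mem_periodLattice`,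
  `finite_filmBase`); §2 **`film_conj4_of_periodic`**, `film_criticalContinuity_of_periodic`, `film_criticalProb_lt_one_of_periodic`.
[cite: Kesten1982, §2.1 Def. 1 (periodic graphs)] [cite: DuminilCopinSidoraviciusTassion2016, Thm. 1 + p. 3 "Two generalizations"]
[cite: GrimmettPercolation1999, §7.2 p. 148 (slabs), §12.1 p. 349] [cite: BenjaminiSchramm1996, §2 and Conj. 4]
-/

noncomputable section

namespace Summit.CriticalPhenomena.PercolationContinuityZ3.Theorems.Transplant

open SimpleGraph Literature.Barriers.CriticalPhenomena Literature.Probability.LatticeModels Literature.Probability.Percolation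
open scoped Classical

namespace Z3Net

variable (N : Z3Net)

/-! ## §1 Horizontal residues and the film's base vertices -/

/-- The horizontal residue `(v₀ mod n₀, v₁ mod n₁, v₂)` stays in the film. [folklore] -/
theorem hres_mem_film (n : Fin 3 → ℕ) {a b : ℤ} {v : Site 3} (hv : v ∈ film a b) :
    (![v 0 % (n 0 : ℤ), v 1 % (n 1 : ℤ), v 2] : Site 3) ∈ film a b := by
  rw [mem_film] at hv ⊢; simpa using hv

/-- `v` minus its horizontal residue is the HORIZONTAL period vector `(n₀ (v₀ / n₀), n₁ (v₁ / n₁), 0)`. [folklore] -/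
theorem sub_hres_eq (n : Fin 3 → ℕ) (v : Site 3) :
    v - ![v 0 % (n 0 : ℤ), v 1 % (n 1 : ℤ), v 2] = ![(n 0 : ℤ) * (v 0 / (n 0 : ℤ)), (n 1 : ℤ) * (v 1 / (n 1 : ℤ)), 0] := by
  funext i
  fin_cases i
  · simp; linarith [Int.emod_add_mul_ediv (v 0) (n 0 : ℤ)]
  · simp; linarith [Int.emod_add_mul_ediv (v 1) (n 1 : ℤ)]
  · simp

/-- The film base vertices with horizontal coordinates in `[0,n₀) × [0,n₁)` form a finite set. [folklore] -/
theorem finite_filmBase (n : Fin 3 → ℕ) (a b : ℤ) :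
    {v : film a b | 0 ≤ (v : Site 3) 0 ∧ (v : Site 3) 0 < n 0 ∧ 0 ≤ (v : Site 3) 1 ∧ (v : Site 3) 1 < n 1}.Finite := by
  refine Set.Finite.of_finite_image (f := fun v : film a b => ((v : Site 3) 0, (v : Site 3) 1, (v : Site 3) 2)) ?_ ?_
  · refine ((Set.finite_Ico (0 : ℤ) (n 0)).prod ((Set.finite_Ico (0 : ℤ) (n 1)).prod (Set.finite_Icc a b))).subset ?_
    rintro _ ⟨v, ⟨h0, h0', h1, h1'⟩, rfl⟩
    have hv := (mem_film (w := (v : Site 3))).1 v.2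
    simp only [Set.mem_prod, Set.mem_Ico, Set.mem_Icc]
    exact ⟨⟨h0, h0'⟩, ⟨h1, h1'⟩, hv⟩
  · intro x _ y _ h
    simp only [Prod.mk.injEq] at h
    apply Subtype.ext
    funext i; fin_cases i
    · exact h.1
    · exact h.2.1
    · exact h.2.2

/-! ## §2 The film is doubly periodic -/

/-- **Every CONNECTED `(001)`-film of every periodic net on `ℤ³` has `p_c < 1` and dies at its own critical point, at every vertex** — from the rung-Q node via
`AutChart.conj4_zTwoPeriodic_holds`: the horizontal period lattice acts by the scaled translations `x ↦ x + (n₀a₀, n₁a₁, 0)`, by automorphisms, freely, with the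
finitely many orbits of `[0,n₀) × [0,n₁) × [a,b]`.  Film-connectedness is a hypothesis (films can be disconnected).  builds on p205010 (kernel theorem,
internal audit signed; external expert review pending). [cite: Kesten1982, §2.1 Def. 1] [cite: BenjaminiSchramm1996, Conj. 4; §2]
[cite: DuminilCopinSidoraviciusTassion2016, Thm. 1] -/
theorem film_conj4_of_periodic {n : Fin 3 → ℕ} (h : N.Periodic n) (hn : ∀ i, 0 < n i) (a b : ℤ)
    (hc : (N.graph.induce (film a b)).Connected) (v : film a b) :
    criticalProb (N.graph.induce (film a b)) v < 1 ∧
      theta (N.graph.induce (film a b)) v (criticalProbIOf (N.graph.induce (film a b)) v) = 0 := by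
  -- the horizontal translation vector of `a : ℤ²`, scaled by the periods
  have hmemL : ∀ a' : Site 2, (![(n 0 : ℤ) * a' 0, (n 1 : ℤ) * a' 1, 0] : Site 3) ∈ periodLattice n := by
    intro a' i
    fin_cases i
    · exact dvd_mul_right _ _
    · exact dvd_mul_right _ _
    · simp
  have hmemF : ∀ (a' : Site 2) (x : film a b), (x : Site 3) + ![(n 0 : ℤ) * a' 0, (n 1 : ℤ) * a' 1, 0] ∈ film a b := by
    intro a' x
    have hx := (mem_film (w := (x : Site 3))).1 x.2
    rw [mem_film]; simpa using hx
  -- the `ℤ²`-action (a local instance on the film's vertex type)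
  letI inst : MulAction (Multiplicative (Site 2)) (film a b) :=
    { smul := fun a' x => ⟨(x : Site 3) + ![(n 0 : ℤ) * Multiplicative.toAdd a' 0, (n 1 : ℤ) * Multiplicative.toAdd a' 1, 0], hmemF _ x⟩
      one_smul := fun x => Subtype.ext (by
        change (x : Site 3) + _ = (x : Site 3)
        funext i; fin_cases i <;> simp)
      mul_smul := fun a' b' x => Subtype.ext (by
        change (x : Site 3) + _ = ((x : Site 3) + _) + _
        rw [add_assoc]; congr 1
        funext i; fin_cases i <;> simp <;> ring) }
  have hcoe : ∀ (a' : Multiplicative (Site 2)) (x : film a b), ((a' • x : film a b) : Site 3) =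
      (x : Site 3) + ![(n 0 : ℤ) * Multiplicative.toAdd a' 0, (n 1 : ℤ) * Multiplicative.toAdd a' 1, 0] := fun _ _ => rfl
  -- by automorphisms
  have hact : IsActionByAut (N.graph.induce (film a b)) (Multiplicative (Site 2)) := by
    intro a' x y
    change N.graph.Adj ((x : Site 3) + _) ((y : Site 3) + _) ↔ N.graph.Adj (x : Site 3) (y : Site 3)
    refine ⟨fun hxy => ?_, N.adj_add_right h (hmemL _)⟩
    have := N.adj_add_right h (neg_mem_periodLattice (hmemL (Multiplicative.toAdd a'))) hxy
    rwa [add_neg_cancel_right, add_neg_cancel_right] at this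
  -- free
  have hfree : ∀ (a' : Multiplicative (Site 2)) (x : film a b), a' • x = x → a' = 1 := by
    intro a' x hx
    have h' : (x : Site 3) + ![(n 0 : ℤ) * Multiplicative.toAdd a' 0, (n 1 : ℤ) * Multiplicative.toAdd a' 1, 0] = (x : Site 3) := by
      rw [← hcoe]; exact congrArg (fun y : film a b => (y : Site 3)) hx
    rw [add_eq_left] at h'
    have h0 : (n 0 : ℤ) * Multiplicative.toAdd a' 0 = 0 := by simpa using congrFun h' 0
    have h1 : (n 1 : ℤ) * Multiplicative.toAdd a' 1 = 0 := by simpa using congrFun h' 1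
    refine Multiplicative.toAdd.injective ?_
    rw [toAdd_one]
    funext i; fin_cases i
    · exact (mul_eq_zero.1 h0).resolve_left (by exact_mod_cast (hn 0).ne')
    · exact (mul_eq_zero.1 h1).resolve_left (by exact_mod_cast (hn 1).ne')
  -- finitely many orbits
  have hcover : ∀ w : film a b, ∃ a' : Multiplicative (Site 2), ∃ r ∈ (finite_filmBase n a b).toFinset, a' • r = w := by
    intro w
    refine ⟨Multiplicative.ofAdd ![(w : Site 3) 0 / (n 0 : ℤ), (w : Site 3) 1 / (n 1 : ℤ)],
      ⟨![(w : Site 3) 0 % (n 0 : ℤ), (w : Site 3) 1 % (n 1 : ℤ), (w : Site 3) 2], hres_mem_film n w.2⟩, ?_, ?_⟩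
    · rw [Set.Finite.mem_toFinset, Set.mem_setOf_eq]
      have h0 := hn 0; have h1 := hn 1
      simp only [Matrix.cons_val_zero, Matrix.cons_val_one]
      exact ⟨Int.emod_nonneg _ (by exact_mod_cast h0.ne'), Int.emod_lt_of_pos _ (by exact_mod_cast h0),
        Int.emod_nonneg _ (by exact_mod_cast h1.ne'), Int.emod_lt_of_pos _ (by exact_mod_cast h1)⟩
    · apply Subtype.ext
      rw [hcoe, toAdd_ofAdd]
      funext i; fin_cases i
      · simp; linarith [Int.emod_add_mul_ediv ((w : Site 3) 0) (n 0 : ℤ)]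
      · simp; linarith [Int.emod_add_mul_ediv ((w : Site 3) 1) (n 1 : ℤ)]
      · simp
  exact AutChart.conj4_zTwoPeriodic_holds hact hfree hc (finite_filmBase n a b).toFinset hcover v

/-- **`θ_v(p_c) = 0` at every vertex of every connected `(001)`-film of every periodic net on `ℤ³`.** builds on p205010 (kernel theorem, internal audit
signed; external expert review pending). [cite: DuminilCopinSidoraviciusTassion2016, Thm. 1] [cite: BenjaminiSchramm1996, Conj. 4] -/
theorem film_criticalContinuity_of_periodic {n : Fin 3 → ℕ} (h : N.Periodic n) (hn : ∀ i, 0 < n i) (a b : ℤ)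
    (hc : (N.graph.induce (film a b)).Connected) (v : film a b) :
    theta (N.graph.induce (film a b)) v (criticalProbIOf (N.graph.induce (film a b)) v) = 0 :=
  (N.film_conj4_of_periodic h hn a b hc v).2

/-- **`p_c < 1` on every connected `(001)`-film of every periodic net on `ℤ³`.** builds on p205010 (kernel theorem, internal audit signed; external expert
review pending). [cite: BenjaminiSchramm1996, Thm. 1 / §2] -/
theorem film_criticalProb_lt_one_of_periodic {n : Fin 3 → ℕ} (h : N.Periodic n) (hn : ∀ i, 0 < n i) (a b : ℤ)
    (hc : (N.graph.induce (film a b)).Connected) (v : film a b) :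
    criticalProb (N.graph.induce (film a b)) v < 1 :=
  (N.film_conj4_of_periodic h hn a b hc v).1

end Z3Net

end Summit.CriticalPhenomena.PercolationContinuityZ3.Theorems.Transplant

end
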